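import Summits.AnomalousDissipation.AnomalousDissipation.Theorems.SolenoidalFractalHomogenisationLagrangianStepOneLevelDefs
import Summits.AnomalousDissipation.AnomalousDissipation.Theorems.SolenoidalFractalHomogenisationLagrangianStepTailScales
import HarnessLib

/-!
# K1L `LagrangianRenormalisationStep` (stmt-AnomalousDissipation-24912), line `onelevel`: the SCALES of the one-level step
# (helper; `--supports stmt-AnomalousDissipation-24912 --as helper`)

Helper file of route `SolenoidalFractalHomogenisation` for the registered stub `stub_oneLevelL` (skeleton v21): the exact ALGEBRAIC
identifications behind the named renormalisation recursion `renormStep`, kernel-checked once so that every later piece of the one-level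
comparison (Lagrangian conjugation, cell comparison, assembly) talks about the same objects.

For the bookkeeping data `D : FractalCarrierData k` of a carrier (`E.toFractalCarrierData` for a Lagrangian lattice carrier `E`), level
`m + 1` with cell viscosity `ν = cellVisc (m+1) = kbar (m+1) N (m+1)² / a (m+1)`, `n = N (m+1)` cells and shear rate `a (m+1)`:

* `relGain_eq` — the relative gain `gain / ν²` IS the Taylor-recursion quotient `gain·a²/(kbar² N⁴)` of `Permissible` (clause 4);
* `kbar_eq_kbar_succ_mul` — under `Permissible`, `kbar m = kbar (m+1) · (1 + gain/ν²)`;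
* `kbar_smul_renormStep` — hence the level-`m` RENORMALISED tensor of `stub_oneLevelL` loses its normalising denominator:
  `kbar m • renormStep Φ (gain/ν²) S = kbar (m+1) • (S + (gain/ν²) • Φ S)`;
* `kbar_eq_potentialScale_mul_cellVisc`, `kbar_smul_eq_cell` — physical ↔ cell units: `kbar (m+1) • S = a (m+1) • ((1/n²) • (ν • S))`, i.e. the
  level-`(m+1)` viscosity tensor is the cell package's `(1/n²) • 𝔸`, `𝔸 = ν • S`, read in cell time `s = a (m+1) · t`;
* `kbar_smul_renormStep_eq_cell` — and the renormalised level-`m` tensor is, in the same units, EXACTLY the EFFECTIVE tensor of the slow-vector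
  clause (V): `kbar m • renormStep Φ (gain/ν²) S = a (m+1) • ((1/n²) • (𝔸 + (gain/ν) • Φ ((1/ν) • 𝔸)))` (with `(1/ν) • 𝔸 = S`);
* `word_succ_eq_stretch`, `level_succ_eq_cellField`, `physPeriod_succ_eq` — for a carrier replaying the pre-stretched design `W.stretch M`
  (`E.design = W.stretch M hM`): the level-`(m+1)` word is `(W.stretch M).stretch (1/ν)`, the Eulerian level field is the cell carrier of the
  clauses run at shear rate `a (m+1)` — `level (m+1) t = a (m+1) • cellField W M hM ν _ n (a (m+1) · t)` — and its physical period is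
  `M · W.period / (ν · a (m+1))` (the `P = M·period/ν` of clause (V), in cell time).

Pure algebra on the definitions (`FractalCarrierData.cellVisc/word/level/physPeriod/Permissible`, `LatticeWord.stretch`, `renormStep`,
`cellField`); no analysis, no named facts, no new definitions, no sorry.  This is NOT a proof of the one-level comparison, of the crux, of Onsager's
conjecture or of anomalous dissipation — rung-leaf bookkeeping only.  Prover seat `lead-k1l-onelevel-p1` g0 (line lead of K1L «onelevel»), 2026-08-28.
-/

set_option linter.dupNamespace false

noncomputable section

namespace Summit.AnomalousDissipation.AnomalousDissipation.Theorems.SolenoidalFractalHomogenisation.LagrangianStep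

open Literature.Analysis Literature.Analysis.FluidPDE Literature.Analysis.FunctionSpaces
open Literature.Analysis.FluidPDE.LatticeShear
open Summit.AnomalousDissipation.AnomalousDissipation.Theorems.SolenoidalFractalHomogenisation.LagrangianRenormalisationStep (cellVisc_pos')

variable {k : ℕ}

/-! ## The relative gain and the Taylor recursion -/

/-- The relative gain of level `m+1`, `gain / cellVisc (m+1)²`, is the quotient `gain · a² / (kbar² N⁴)` of the Taylor recursion
(`Permissible`, clause 4). [cite: ArmstrongVicol2025, §3 (3.42)–(3.43) (parameter bookkeeping, transposed)] -/
theorem relGain_eq (D : FractalCarrierData k) (m : ℕ) :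
    D.gain / D.cellVisc (m + 1) ^ 2 = D.gain * D.a (m + 1) ^ 2 / (D.kbar (m + 1) ^ 2 * (D.N (m + 1) : ℝ) ^ 4) := by
  have ha : D.a (m + 1) ≠ 0 := (D.a_pos _).ne'
  have hk : D.kbar (m + 1) ≠ 0 := (D.kbar_pos _).ne'
  have hN : (D.N (m + 1) : ℝ) ≠ 0 := by exact_mod_cast (D.N_pos _).ne'
  unfold FractalCarrierData.cellVisc
  field_simp

/-- The relative gain is nonnegative. [folklore] -/
theorem relGain_nonneg (D : FractalCarrierData k) (m : ℕ) : 0 ≤ D.gain / D.cellVisc (m + 1) ^ 2 :=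
  div_nonneg D.gain_pos.le (sq_nonneg _)

/-- `1 + gain / cellVisc (m+1)² > 0`. [folklore] -/
theorem one_add_relGain_pos (D : FractalCarrierData k) (m : ℕ) : 0 < 1 + D.gain / D.cellVisc (m + 1) ^ 2 := by
  have := relGain_nonneg D m
  linarith

/-- **Taylor recursion in relative-gain form.**  Under `Permissible`: `kbar m = kbar (m+1) · (1 + gain / cellVisc (m+1)²)`.
[cite: ArmstrongVicol2025, §3 (3.42)–(3.43) (parameter bookkeeping, transposed)] -/
theorem kbar_eq_kbar_succ_mul (D : FractalCarrierData k) (hP : D.Permissible) (m : ℕ) :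
    D.kbar m = D.kbar (m + 1) * (1 + D.gain / D.cellVisc (m + 1) ^ 2) := by
  rw [relGain_eq]
  exact hP.2.2.2.1 m

/-- The ratio `kbar m / kbar (m+1)` is the gain factor `1 + gain / cellVisc (m+1)²`. [folklore] -/
theorem kbar_div_kbar_succ (D : FractalCarrierData k) (hP : D.Permissible) (m : ℕ) :
    D.kbar m / D.kbar (m + 1) = 1 + D.gain / D.cellVisc (m + 1) ^ 2 := by
  rw [kbar_eq_kbar_succ_mul D hP m, mul_div_cancel_left₀ _ (D.kbar_pos _).ne']

/-! ## The renormalised tensor of `stub_oneLevelL` -/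

/-- **The normalising denominator of `renormStep` is the gain factor.**  Under `Permissible`, for every shape map `Φ` and shape `S`:
`kbar m • renormStep Φ (gain / cellVisc (m+1)²) S = kbar (m+1) • (S + (gain / cellVisc (m+1)²) • Φ S)` — the level-`m` renormalised
tensor of `stub_oneLevelL` is the level-`(m+1)` viscosity times (identity + relative gain × large-gain shape map).
[cite: ArmstrongVicol2025, §3 (3.42)–(3.43) (the renormalised diffusivities κ_{m−1} = κ_m + c a_m² ε_m⁴/κ_m, transposed)] -/
theorem kbar_smul_renormStep (D : FractalCarrierData k) (hP : D.Permissible) (Φ : Torus.Visc4 (Fin 3) → Torus.Visc4 (Fin 3))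
    (S : Torus.Visc4 (Fin 3)) (m : ℕ) :
    D.kbar m • renormStep Φ (D.gain / D.cellVisc (m + 1) ^ 2) S =
      D.kbar (m + 1) • (S + (D.gain / D.cellVisc (m + 1) ^ 2) • Φ S) := by
  have hg := one_add_relGain_pos D m
  rw [renormStep, smul_smul, kbar_eq_kbar_succ_mul D hP m, mul_assoc, mul_one_div, div_self hg.ne', mul_one]

/-! ## Physical units versus cell units -/

/-- `kbar m = (a m / N m²) · cellVisc m` (the definition of the cell viscosity, solved for `kbar`). [folklore] -/
theorem kbar_eq_potentialScale_mul_cellVisc (D : FractalCarrierData k) (m : ℕ) :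
    D.kbar m = D.a m / (D.N m : ℝ) ^ 2 * D.cellVisc m := by
  have ha : D.a m ≠ 0 := (D.a_pos _).ne'
  have hN : (D.N m : ℝ) ≠ 0 := by exact_mod_cast (D.N_pos _).ne'
  unfold FractalCarrierData.cellVisc
  field_simp

/-- `kbar m = a m · ((1 / N m²) · cellVisc m)`: the physical viscosity is the cell package's `(1/n²)·ν` read in cell time `s = a·t`. [folklore] -/
theorem kbar_eq_a_mul (D : FractalCarrierData k) (m : ℕ) :
    D.kbar m = D.a m * (1 / (D.N m : ℝ) ^ 2 * D.cellVisc m) := by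
  rw [kbar_eq_potentialScale_mul_cellVisc]
  ring

/-- **Level-`(m+1)` viscosity tensor in cell units.**  `kbar (m+1) • S = a (m+1) • ((1/n²) • (ν • S))` with `ν = cellVisc (m+1)`,
`n = N (m+1)`: the tensor `(1/n²) • 𝔸`, `𝔸 = ν • S`, of the cell clauses, times the time-rescaling factor `a (m+1)`. [folklore] -/
theorem kbar_smul_eq_cell (D : FractalCarrierData k) (S : Torus.Visc4 (Fin 3)) (m : ℕ) :
    D.kbar (m + 1) • S = D.a (m + 1) • ((1 / (D.N (m + 1) : ℝ) ^ 2) • (D.cellVisc (m + 1) • S)) := by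
  funext i a' j b
  simp only [Pi.smul_apply, smul_eq_mul]
  rw [kbar_eq_a_mul]
  ring

/-- `(1/ν) • (ν • S) = S` for the (positive) cell viscosity. [folklore] -/
theorem inv_cellVisc_smul_cellVisc_smul (D : FractalCarrierData k) (S : Torus.Visc4 (Fin 3)) (m : ℕ) :
    (1 / D.cellVisc m) • (D.cellVisc m • S) = S := by
  rw [smul_smul, one_div_mul_cancel (cellVisc_pos' D m).ne', one_smul]

/-- **The renormalised level-`m` tensor IS the effective tensor of clause (V), in cell units.**  Under `Permissible`, with
`ν = cellVisc (m+1)`, `n = N (m+1)`, `𝔸 = ν • S`: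
`kbar m • renormStep Φ (gain/ν²) S = a (m+1) • ((1/n²) • (𝔸 + (gain/ν) • Φ ((1/ν) • 𝔸)))` — literally the tensor
`(1 / (n:ℝ) ^ 2) • (𝔸 + (c / ν) • Φ ((1 / ν) • 𝔸))` of `SlowVectorClause W M hM c Φ …` at `c = gain`, times the time-rescaling factor.
[cite: ArmstrongVicol2025, Prop. 5.2 (the homogenised problem of the one-level step, transposed to the tensor cell package)] -/
theorem kbar_smul_renormStep_eq_cell (D : FractalCarrierData k) (hP : D.Permissible)
    (Φ : Torus.Visc4 (Fin 3) → Torus.Visc4 (Fin 3)) (S : Torus.Visc4 (Fin 3)) (m : ℕ) :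
    D.kbar m • renormStep Φ (D.gain / D.cellVisc (m + 1) ^ 2) S =
      D.a (m + 1) • ((1 / (D.N (m + 1) : ℝ) ^ 2) •
        (D.cellVisc (m + 1) • S + (D.gain / D.cellVisc (m + 1)) • Φ ((1 / D.cellVisc (m + 1)) • (D.cellVisc (m + 1) • S)))) := by
  have hν : D.cellVisc (m + 1) ≠ 0 := (cellVisc_pos' D (m + 1)).ne'
  have hN : (D.N (m + 1) : ℝ) ≠ 0 := by exact_mod_cast (D.N_pos _).ne'
  rw [kbar_smul_renormStep D hP, inv_cellVisc_smul_cellVisc_smul]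
  funext i a' j b
  simp only [Pi.smul_apply, Pi.add_apply, smul_eq_mul]
  rw [kbar_eq_potentialScale_mul_cellVisc D (m + 1)]
  field_simp

/-! ## The design: level field ↔ cell carrier of the clauses -/

/-- The period of a stretched word is the stretch factor times the period (same statement as `…PermissibleCarrier.period_stretch`,
re-proved here in two lines so that this helper does not import a module of the route file's cone). [folklore] -/
theorem period_stretch' (W : LatticeWord k) (s : ℝ) (hs : 0 < s) : (W.stretch s hs).period = s * W.period := by
  unfold LatticeWord.period LatticeWord.stretch
  simp [Finset.mul_sum]

/-- The level-`m` word of a carrier replaying the pre-stretched design `W.stretch M` is `(W.stretch M).stretch (1 / cellVisc m)` (quasi-static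
replay at its own cell viscosity). [folklore] -/
theorem word_eq_stretch (D : FractalCarrierData k) {W : LatticeWord k} {M : ℝ} {hM : 0 < M} (hW : D.design = W.stretch M hM) (m : ℕ)
    (hν : 0 < D.cellVisc m) :
    D.word m = (W.stretch M hM).stretch (1 / D.cellVisc m) (one_div_pos.mpr hν) := by
  unfold FractalCarrierData.word FractalCarrierData.slotStretch
  rw [hW]

/-- **The Eulerian level field IS the cell carrier of the clauses, run at the level's shear rate.**  If `E.design = W.stretch M hM` then
`level (m+1) t x = a (m+1) • cellField W M hM (cellVisc (m+1)) _ (N (m+1)) (a (m+1) · t) x` — the carrier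
`cellField W M hM ν hν.1 n` of `SlowVectorClause` / `CellEnergyClauses` at `ν = cellVisc (m+1)`, `n = N (m+1)`, in cell time `s = a (m+1)·t`.
[cite: ArmstrongVicol2025, §2.2 (PDF p. 18: the Eulerian level v_m inserted in the Lagrangian coordinates)] -/
theorem level_eq_cellField (D : FractalCarrierData k) {W : LatticeWord k} {M : ℝ} {hM : 0 < M} (hW : D.design = W.stretch M hM) (m : ℕ)
    (hν : 0 < D.cellVisc m) (t : ℝ) (x : UnitAddTorus (Fin 3)) :
    D.level m t x = D.a m • cellField W M hM (D.cellVisc m) hν (D.N m) (D.a m * t) x := by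
  unfold FractalCarrierData.level cellField
  rw [word_eq_stretch D hW m hν]

/-- The physical period of level `m` of a carrier replaying `W.stretch M`: `physPeriod m = M · W.period / (cellVisc m · a m)` — the
`P = M · period / ν` of clause (V) divided by the shear rate (cell time → physical time). [folklore] -/
theorem physPeriod_eq (D : FractalCarrierData k) {W : LatticeWord k} {M : ℝ} {hM : 0 < M} (hW : D.design = W.stretch M hM) (m : ℕ) :
    D.physPeriod m = M * W.period / (D.cellVisc m * D.a m) := by
  have hν := cellVisc_pos' D m
  unfold FractalCarrierData.physPeriod
  rw [word_eq_stretch D hW m hν, period_stretch', period_stretch']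
  field_simp

end Summit.AnomalousDissipation.AnomalousDissipation.Theorems.SolenoidalFractalHomogenisation.LagrangianStep

end
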